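import Mathlib
import Summits.RiemannHypothesis.RiemannHypothesis.Theorems.SoloBlindUniversalInvisible

/-!
# SoloBlind artefact 17 — Theorem U′: the universal shallow-pair bound with the constant ½·arccosh 2

Context (soloist `solo-RiemannHypothesis-blind`, report `paper/window-height.md` §12.6, claim C61).  Same setting and
notation as artefact 16 (`SoloBlindUniversalInvisible`): window `(-a, a]`, `g ∈ L²` supported there, on-line lattice
`u_j = u₀ + js` with `2a ≤ 2π/s`, an ARBITRARY set of sites `P ⊆ ℤ` at which the on-line zero is replaced by the pair
`u_j ∓ iδ`; `Q(g) = Σ_{j∉P} |H(u_j)|² + Σ_{j∈P} 2Re[H(u_j - iδ) conj H(u_j + iδ)]`.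

* `soloBlind_universal_sharp`:  `Q(g) ≥ (2π/s)·(1 - 2 sinh²(δa))·‖g‖₂²` for every `P`, `u₀`, `g`
  (artefact 16 had the weaker factor `1 - 2 sinh²(δa) - 2(cosh(δa) - 1)²`).
* `soloBlind_universal_sharp_nonneg`: hence `Q(g) ≥ 0` for all `P, g` as soon as `2 sinh²(δa) ≤ 1`, i.e.
  `δa ≤ arsinh(1/√2) = ½·arccosh 2 = 0.65848` (`soloBlind_universal_sharp_nonneg_of_le` states it with `Real.arsinh (√2/2)`).

Mechanism.  With `c = cosh(δa)`, `ρ = 2/(2c² - 1)`, `C_j = ∫ g cosh(δ·) e^{iu_j·}`, `S_j = ∫ g sinh(δ·) e^{iu_j·}`,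
`K_j = ∫ g (c - cosh(δ·)) e^{iu_j·} = c·H(u_j) - C_j`:  the one-line identity
`(2c² - 1)·(2|C|² + ρ|cH - C|² - |H|²) = |H - 2c·C|² ≥ 0` gives the termwise minorant
`pair_j = 2|C_j|² - 2|S_j|² ≥ |H(u_j)|² - ρ|K_j|² - 2|S_j|²` (also trivially true for the on-line term), and Theorem D1
(artefact 7/16) sums the three lattice series exactly: `Q ≥ (2π/s) ∫ |g|²·(1 - ρ(c - cosh δx)² - 2 sinh² δx) dx`; finally
`ρ(c - y)² + 2(y² - 1) ≤ 2(c² - 1)` for `y = cosh(δx) ∈ [1, c]`.  The prose (§12.6) shows this is the OPTIMUM of all bounds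
that use only the Gram sums of `(H_j, C_j, S_j)` (moment/SDP duality; extremiser = mass at the window edge).

Mathlib + artefacts 7/13/16 only; no sorries.
-/

open MeasureTheory Complex Set
open scoped Real ComplexConjugate

namespace Summit.RiemannHypothesis.RiemannHypothesis.Theorems

/-- The pointwise algebra of Theorem U′: for complex `H, C, S`, real `c` with `1 ≤ c` and `ρ = 2/(2c² - 1)`,
`‖H‖² - ρ‖c·H - C‖² - 2‖S‖² ≤ 2‖C‖² - 2‖S‖²` (because `(2c²-1)(2‖C‖² + ρ‖cH - C‖² - ‖H‖²) = ‖H - 2cC‖²`). -/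
theorem soloBlind_sharp_pointwise (H C S : ℂ) {c ρ : ℝ} (hc : 1 ≤ c) (hρ : ρ * (2 * c ^ 2 - 1) = 2) :
    ‖H‖ ^ 2 - ρ * ‖(c : ℂ) * H - C‖ ^ 2 - 2 * ‖S‖ ^ 2 ≤ 2 * ‖C‖ ^ 2 - 2 * ‖S‖ ^ 2 := by
  have h2c : 0 < 2 * c ^ 2 - 1 := by nlinarith
  rw [Complex.sq_norm, Complex.sq_norm, Complex.sq_norm, Complex.sq_norm, Complex.normSq_apply,
    Complex.normSq_apply, Complex.normSq_apply, Complex.normSq_apply]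
  simp only [Complex.sub_re, Complex.sub_im, Complex.mul_re, Complex.mul_im, Complex.ofReal_re,
    Complex.ofReal_im, zero_mul, sub_zero, add_zero]
  have key : (2 * c ^ 2 - 1) * (2 * (C.re * C.re + C.im * C.im)
      + ρ * ((c * H.re - C.re) * (c * H.re - C.re) + (c * H.im - C.im) * (c * H.im - C.im))
      - (H.re * H.re + H.im * H.im))
      = (H.re - 2 * c * C.re) ^ 2 + (H.im - 2 * c * C.im) ^ 2 := by
    have hρ' : ρ = 2 / (2 * c ^ 2 - 1) := by
      rw [eq_div_iff (ne_of_gt h2c)]; exact hρ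
    rw [hρ']
    field_simp
    ring
  have hnn : 0 ≤ 2 * (C.re * C.re + C.im * C.im)
      + ρ * ((c * H.re - C.re) * (c * H.re - C.re) + (c * H.im - C.im) * (c * H.im - C.im))
      - (H.re * H.re + H.im * H.im) := by
    have h0 : 0 ≤ (2 * c ^ 2 - 1) * (2 * (C.re * C.re + C.im * C.im)
      + ρ * ((c * H.re - C.re) * (c * H.re - C.re) + (c * H.im - C.im) * (c * H.im - C.im))
      - (H.re * H.re + H.im * H.im)) := by rw [key]; positivity
    exact (mul_nonneg_iff_of_pos_left h2c).mp h0
  linarith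

/-- The weight inequality of Theorem U′: for `1 ≤ y ≤ c` and `ρ(2c² - 1) = 2`,
`ρ (c - y)² + 2 (y² - 1) ≤ 2 (c² - 1)`. -/
theorem soloBlind_sharp_weight {y c ρ : ℝ} (hy : 1 ≤ y) (hyc : y ≤ c) (hρ : ρ * (2 * c ^ 2 - 1) = 2)
    (hρ0 : 0 ≤ ρ) : ρ * (c - y) ^ 2 + 2 * (y ^ 2 - 1) ≤ 2 * (c ^ 2 - 1) := by
  have hc : 1 ≤ c := hy.trans hyc
  have hρ2 : ρ ≤ 2 := by
    nlinarith [mul_le_mul_of_nonneg_left (show (1:ℝ) ≤ 2 * c ^ 2 - 1 by nlinarith) hρ0]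
  -- (c - y) · (ρ (c - y) - 2 (y + c)) ≤ 0
  nlinarith [mul_nonneg (sub_nonneg.mpr hyc) (show 0 ≤ 2 * (y + c) - ρ * (c - y) by nlinarith),
    mul_nonneg hρ0 (sub_nonneg.mpr hyc)]

/-- **Theorem U′ (universal shallow-pair bound, sharp constant of the second-moment method).**
For `0 < s`, `0 < a`, `2a ≤ 2π/s`, `0 ≤ δ`, any `P ⊆ ℤ`, any `u₀` and every `g ∈ L²` supported in `(-a, a]`, the
mixed-configuration functional is at least `(2π/s)(1 - 2 sinh²(δa)) ‖g‖₂²`. -/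
theorem soloBlind_universal_sharp (s δ a u₀ : ℝ) (hs : 0 < s) (ha : 0 < a) (hδ : 0 ≤ δ)
    (haT : 2 * a ≤ 2 * π / s) (P : Set ℤ) [DecidablePred (· ∈ P)]
    {g : ℝ → ℂ} (hg : MemLp g 2 volume) (hsupp : Function.support g ⊆ Ioc (-a) a) :
    (2 * π / s) * (1 - 2 * Real.sinh (δ * a) ^ 2) * (∫ x : ℝ, ‖g x‖ ^ 2) ≤
      ∑' j : ℤ, (if j ∈ P then
        2 * ((∫ x : ℝ, g x * cexp (I * (((u₀ + j * s : ℝ) : ℂ) - I * δ) * (x : ℂ))) *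
            conj ((∫ x : ℝ, g x * cexp (I * (((u₀ + j * s : ℝ) : ℂ) + I * δ) * (x : ℂ))))).re
      else ‖(∫ x : ℝ, g x * cexp (I * (((u₀ + j * s : ℝ) : ℂ)) * (x : ℂ)))‖ ^ 2) := by
  have hT : 0 < 2 * π / s := by positivity
  obtain ⟨hFsum, -⟩ := soloBlind_universal_invisible s δ a u₀ hs ha hδ haT P hg hsupp
  -- integrability of `g` and `‖g‖²`
  have hgi : Integrable g := by
    have hm : MemLp g 2 (volume.restrict (Ioc (-a) a)) := hg.restrict _
    haveI : IsFiniteMeasure (volume.restrict (Ioc (-a) a)) :=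
      isFiniteMeasure_restrict.mpr (by simp [Real.volume_Ioc])
    have h1 : IntegrableOn g (Ioc (-a) a) := hm.integrable one_le_two
    exact (integrableOn_iff_integrable_of_support_subset hsupp).mp h1
  have hg2 : Integrable (fun x => ‖g x‖ ^ 2) := (memLp_two_iff_integrable_sq_norm hg.1).mp hg
  -- the constants
  set c : ℝ := Real.cosh (δ * a) with hcdef
  have hc1 : 1 ≤ c := Real.one_le_cosh _
  have h2c : 0 < 2 * c ^ 2 - 1 := by nlinarith
  set ρ : ℝ := 2 / (2 * c ^ 2 - 1) with hρdef
  have hρ : ρ * (2 * c ^ 2 - 1) = 2 := by rw [hρdef]; field_simp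
  have hρ0 : 0 ≤ ρ := by rw [hρdef]; positivity
  -- weights and their bounds on the closed window
  have hWs : ∀ x ∈ Icc (-a) a, |Real.sinh (δ * x)| ≤ Real.sinh (δ * a) := by
    intro x hx
    rw [abs_le]
    constructor
    · rw [← Real.sinh_neg, Real.sinh_le_sinh]
      nlinarith [mul_nonneg hδ (show 0 ≤ x + a by linarith [hx.1])]
    · rw [Real.sinh_le_sinh]
      nlinarith [mul_nonneg hδ (show 0 ≤ a - x by linarith [hx.2])]
  have hWc : ∀ x ∈ Icc (-a) a, |Real.cosh (δ * x)| ≤ Real.cosh (δ * a) := by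
    intro x hx
    rw [abs_of_pos (Real.cosh_pos _), Real.cosh_le_cosh, abs_mul, abs_mul, abs_of_nonneg hδ,
      abs_of_pos ha]
    exact mul_le_mul_of_nonneg_left (abs_le.mpr ⟨by linarith [hx.1], hx.2⟩) hδ
  have hWk : ∀ x ∈ Icc (-a) a, |c - Real.cosh (δ * x)| ≤ c - 1 := by
    intro x hx
    have h1 : 1 ≤ Real.cosh (δ * x) := Real.one_le_cosh _
    have h2 := hWc x hx
    rw [abs_of_pos (Real.cosh_pos _)] at h2
    rw [abs_of_nonneg (by linarith)]
    linarith
  have hcont_s : Continuous fun x : ℝ => Real.sinh (δ * x) :=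
    Real.continuous_sinh.comp (continuous_const.mul continuous_id)
  have hcont_c : Continuous fun x : ℝ => Real.cosh (δ * x) :=
    Real.continuous_cosh.comp (continuous_const.mul continuous_id)
  have hcont_k : Continuous fun x : ℝ => c - Real.cosh (δ * x) := continuous_const.sub hcont_c
  have hGS2 : MemLp (fun x => g x * ((Real.sinh (δ * x) : ℝ) : ℂ)) 2 volume :=
    soloBlind_memLp_mul_weight (w := fun x => Real.sinh (δ * x)) hg hsupp hcont_s _ hWs
  have hGK2 : MemLp (fun x => g x * (((c - Real.cosh (δ * x) : ℝ)) : ℂ)) 2 volume :=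
    soloBlind_memLp_mul_weight (w := fun x => c - Real.cosh (δ * x)) hg hsupp hcont_k _ hWk
  have hGSi : Integrable (fun x => g x * ((Real.sinh (δ * x) : ℝ) : ℂ)) :=
    soloBlind_integrable_mul_weight (w := fun x => Real.sinh (δ * x)) hgi hsupp hcont_s _ hWs
  have hGCi : Integrable (fun x => g x * ((Real.cosh (δ * x) : ℝ) : ℂ)) :=
    soloBlind_integrable_mul_weight (w := fun x => Real.cosh (δ * x)) hgi hsupp hcont_c _ hWc
  have hGKi : Integrable (fun x => g x * (((c - Real.cosh (δ * x) : ℝ)) : ℂ)) :=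
    soloBlind_integrable_mul_weight (w := fun x => c - Real.cosh (δ * x)) hgi hsupp hcont_k _ hWk
  have hsuppT : Function.support g ⊆ Ioc (-a) (-a + 2 * π / s) :=
    hsupp.trans (Ioc_subset_Ioc_right (by linarith))
  have hsub : ∀ w : ℝ → ℝ,
      Function.support (fun x => g x * ((w x : ℝ) : ℂ)) ⊆ Ioc (-a) (-a + 2 * π / s) :=
    fun w => (Function.support_mul_subset_left _ _).trans hsuppT
  -- the three lattice sums (Theorem D1 at δ = 0)
  have hH := soloBlind_lattice_normSq_hasSum (-a) s u₀ hs hg hsuppT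
  have hS := soloBlind_lattice_normSq_hasSum (-a) s u₀ hs hGS2 (hsub _)
  have hK := soloBlind_lattice_normSq_hasSum (-a) s u₀ hs hGK2 (hsub _)
  -- pointwise identities at each site
  have hHm : ∀ j : ℤ, (∫ x : ℝ, g x * cexp (I * (((u₀ + j * s : ℝ) : ℂ) - I * δ) * (x : ℂ))) =
      (∫ x : ℝ, (g x * ((Real.cosh (δ * x) : ℝ) : ℂ)) * cexp (I * (((u₀ + j * s : ℝ) : ℂ)) * (x : ℂ)))
      + ∫ x : ℝ, (g x * ((Real.sinh (δ * x) : ℝ) : ℂ)) * cexp (I * (((u₀ + j * s : ℝ) : ℂ)) * (x : ℂ)) := by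
    intro j
    rw [← integral_add (soloBlind_integrable_mul_cexp hGCi _) (soloBlind_integrable_mul_cexp hGSi _)]
    congr 1; funext x
    rw [soloBlind_cexp_minus_split]
    ring
  have hHp : ∀ j : ℤ, (∫ x : ℝ, g x * cexp (I * (((u₀ + j * s : ℝ) : ℂ) + I * δ) * (x : ℂ))) =
      (∫ x : ℝ, (g x * ((Real.cosh (δ * x) : ℝ) : ℂ)) * cexp (I * (((u₀ + j * s : ℝ) : ℂ)) * (x : ℂ)))
      - ∫ x : ℝ, (g x * ((Real.sinh (δ * x) : ℝ) : ℂ)) * cexp (I * (((u₀ + j * s : ℝ) : ℂ)) * (x : ℂ)) := by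
    intro j
    rw [← integral_sub (soloBlind_integrable_mul_cexp hGCi _) (soloBlind_integrable_mul_cexp hGSi _)]
    congr 1; funext x
    rw [soloBlind_cexp_plus_split]
    ring
  have hKC : ∀ j : ℤ,
      (∫ x : ℝ, (g x * (((c - Real.cosh (δ * x) : ℝ)) : ℂ)) * cexp (I * (((u₀ + j * s : ℝ) : ℂ)) * (x : ℂ))) =
      (c : ℂ) * (∫ x : ℝ, g x * cexp (I * (((u₀ + j * s : ℝ) : ℂ)) * (x : ℂ)))
      - ∫ x : ℝ, (g x * ((Real.cosh (δ * x) : ℝ) : ℂ)) * cexp (I * (((u₀ + j * s : ℝ) : ℂ)) * (x : ℂ)) := by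
    intro j
    rw [← integral_const_mul, ← integral_sub ((soloBlind_integrable_mul_cexp hgi _).const_mul _)
      (soloBlind_integrable_mul_cexp hGCi _)]
    congr 1; funext x
    push_cast
    ring
  -- abbreviations
  set Hj : ℤ → ℂ := fun j => ∫ x : ℝ, g x * cexp (I * (((u₀ + j * s : ℝ) : ℂ)) * (x : ℂ)) with hHj
  set Cj : ℤ → ℂ := fun j =>
    ∫ x : ℝ, (g x * ((Real.cosh (δ * x) : ℝ) : ℂ)) * cexp (I * (((u₀ + j * s : ℝ) : ℂ)) * (x : ℂ)) with hCj
  set Sj : ℤ → ℂ := fun j =>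
    ∫ x : ℝ, (g x * ((Real.sinh (δ * x) : ℝ) : ℂ)) * cexp (I * (((u₀ + j * s : ℝ) : ℂ)) * (x : ℂ)) with hSj
  set Kj : ℤ → ℂ := fun j =>
    ∫ x : ℝ, (g x * (((c - Real.cosh (δ * x) : ℝ)) : ℂ)) * cexp (I * (((u₀ + j * s : ℝ) : ℂ)) * (x : ℂ))
    with hKj
  have hF : (fun j : ℤ => if j ∈ P then
        2 * ((∫ x : ℝ, g x * cexp (I * (((u₀ + j * s : ℝ) : ℂ) - I * δ) * (x : ℂ))) *
            conj ((∫ x : ℝ, g x * cexp (I * (((u₀ + j * s : ℝ) : ℂ) + I * δ) * (x : ℂ))))).re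
      else ‖(∫ x : ℝ, g x * cexp (I * (((u₀ + j * s : ℝ) : ℂ)) * (x : ℂ)))‖ ^ 2)
      = fun j : ℤ => if j ∈ P then 2 * ‖Cj j‖ ^ 2 - 2 * ‖Sj j‖ ^ 2 else ‖Hj j‖ ^ 2 := by
    funext j
    split_ifs with hj
    · rw [hHm j, hHp j, soloBlind_pairTerm_re]
    · rfl
  -- the minorant `L j = |H_j|² - ρ|K_j|² - 2|S_j|²` and its sum
  have hL : HasSum (fun j : ℤ => ‖Hj j‖ ^ 2 - ρ * ‖Kj j‖ ^ 2 - 2 * ‖Sj j‖ ^ 2)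
      ((2 * π / s) * (∫ x : ℝ, ‖g x‖ ^ 2)
        - ρ * ((2 * π / s) * ∫ x, ‖g x * (((c - Real.cosh (δ * x) : ℝ)) : ℂ)‖ ^ 2)
        - 2 * ((2 * π / s) * ∫ x, ‖g x * ((Real.sinh (δ * x) : ℝ) : ℂ)‖ ^ 2)) :=
    (hH.sub (hK.mul_left ρ)).sub (hS.mul_left 2)
  have hLF : ∀ j : ℤ, ‖Hj j‖ ^ 2 - ρ * ‖Kj j‖ ^ 2 - 2 * ‖Sj j‖ ^ 2
      ≤ (if j ∈ P then 2 * ‖Cj j‖ ^ 2 - 2 * ‖Sj j‖ ^ 2 else ‖Hj j‖ ^ 2) := by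
    intro j
    split_ifs with hj
    · have hKj' : Kj j = (c : ℂ) * Hj j - Cj j := by
        simp only [hKj, hHj, hCj]
        exact hKC j
      rw [hKj']
      exact soloBlind_sharp_pointwise (Hj j) (Cj j) (Sj j) hc1 hρ
    · nlinarith [sq_nonneg ‖Kj j‖, sq_nonneg ‖Sj j‖, mul_nonneg hρ0 (sq_nonneg ‖Kj j‖)]
  rw [hF] at hFsum ⊢
  have hle := hasSum_le hLF hL hFsum.hasSum
  -- the combined weight bound: ρ ∫‖g·(c - cosh)‖² + 2 ∫‖g·sinh‖² ≤ 2 sinh²(δa) ∫‖g‖²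
  have hW : ρ * (∫ x, ‖g x * (((c - Real.cosh (δ * x) : ℝ)) : ℂ)‖ ^ 2)
      + 2 * (∫ x, ‖g x * ((Real.sinh (δ * x) : ℝ) : ℂ)‖ ^ 2)
      ≤ 2 * Real.sinh (δ * a) ^ 2 * ∫ x : ℝ, ‖g x‖ ^ 2 := by
    have hi1 : Integrable (fun x => ‖g x * (((c - Real.cosh (δ * x) : ℝ)) : ℂ)‖ ^ 2) :=
      (memLp_two_iff_integrable_sq_norm hGK2.1).mp hGK2
    have hi2 : Integrable (fun x => ‖g x * ((Real.sinh (δ * x) : ℝ) : ℂ)‖ ^ 2) :=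
      (memLp_two_iff_integrable_sq_norm hGS2.1).mp hGS2
    rw [← integral_const_mul, ← integral_const_mul, ← integral_const_mul,
      ← integral_add (hi1.const_mul _) (hi2.const_mul _)]
    apply integral_mono ((hi1.const_mul _).add (hi2.const_mul _)) (hg2.const_mul _)
    intro x
    by_cases hx : g x = 0
    · simp [hx]
    · have hxI : x ∈ Icc (-a) a := Ioc_subset_Icc_self (hsupp hx)
      have hy1 : 1 ≤ Real.cosh (δ * x) := Real.one_le_cosh _
      have hyc : Real.cosh (δ * x) ≤ c := by
        have h2 := hWc x hxI
        rwa [abs_of_pos (Real.cosh_pos _)] at h2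
      have hw := soloBlind_sharp_weight hy1 hyc hρ hρ0
      have hs2 : Real.sinh (δ * x) ^ 2 = Real.cosh (δ * x) ^ 2 - 1 := by
        nlinarith [Real.cosh_sq (δ * x)]
      have hsa2 : Real.sinh (δ * a) ^ 2 = c ^ 2 - 1 := by
        nlinarith [Real.cosh_sq (δ * a)]
      show ρ * ‖g x * (((c - Real.cosh (δ * x) : ℝ)) : ℂ)‖ ^ 2
          + 2 * ‖g x * ((Real.sinh (δ * x) : ℝ) : ℂ)‖ ^ 2 ≤ 2 * Real.sinh (δ * a) ^ 2 * ‖g x‖ ^ 2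
      rw [norm_mul, norm_mul, Complex.norm_real, Complex.norm_real, Real.norm_eq_abs, Real.norm_eq_abs,
        mul_pow, mul_pow, sq_abs, sq_abs, hs2, hsa2]
      nlinarith [hw, sq_nonneg ‖g x‖, mul_le_mul_of_nonneg_left hw (sq_nonneg ‖g x‖)]
  nlinarith [hle, hW, mul_le_mul_of_nonneg_left hW hT.le]

/-- **Corollary.**  If `2 sinh²(δa) ≤ 1` (i.e. `δa ≤ asinh(1/√2) = ½·arccosh 2 ≈ 0.65848`), every mixed configuration
`Z(P, δ)` has nonnegative zero-side functional on every test function in the window. -/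
theorem soloBlind_universal_sharp_nonneg (s δ a u₀ : ℝ) (hs : 0 < s) (ha : 0 < a) (hδ : 0 ≤ δ)
    (haT : 2 * a ≤ 2 * π / s) (hsmall : 2 * Real.sinh (δ * a) ^ 2 ≤ 1)
    (P : Set ℤ) [DecidablePred (· ∈ P)]
    {g : ℝ → ℂ} (hg : MemLp g 2 volume) (hsupp : Function.support g ⊆ Ioc (-a) a) :
    0 ≤ ∑' j : ℤ, (if j ∈ P then
        2 * ((∫ x : ℝ, g x * cexp (I * (((u₀ + j * s : ℝ) : ℂ) - I * δ) * (x : ℂ))) *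
            conj ((∫ x : ℝ, g x * cexp (I * (((u₀ + j * s : ℝ) : ℂ) + I * δ) * (x : ℂ))))).re
      else ‖(∫ x : ℝ, g x * cexp (I * (((u₀ + j * s : ℝ) : ℂ)) * (x : ℂ)))‖ ^ 2) := by
  have h := soloBlind_universal_sharp s δ a u₀ hs ha hδ haT P hg hsupp
  have hint : 0 ≤ ∫ x : ℝ, ‖g x‖ ^ 2 := integral_nonneg (fun x => by positivity)
  have hT : 0 ≤ 2 * π / s := by positivity
  have := mul_nonneg (mul_nonneg hT (by linarith : (0 : ℝ) ≤ 1 - 2 * Real.sinh (δ * a) ^ 2)) hint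
  linarith

/-- **Corollary (the exact threshold).**  Pairs of common depth `δ` with `δ·a ≤ arsinh(√2/2)` (`= ½·arccosh 2 ≈ 0.65848`)
are invisible in every mixed configuration for every test function in the window. -/
theorem soloBlind_universal_sharp_nonneg_of_le (s δ a u₀ : ℝ) (hs : 0 < s) (ha : 0 < a) (hδ : 0 ≤ δ)
    (haT : 2 * a ≤ 2 * π / s) (hδa : δ * a ≤ Real.arsinh (Real.sqrt 2 / 2))
    (P : Set ℤ) [DecidablePred (· ∈ P)]
    {g : ℝ → ℂ} (hg : MemLp g 2 volume) (hsupp : Function.support g ⊆ Ioc (-a) a) :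
    0 ≤ ∑' j : ℤ, (if j ∈ P then
        2 * ((∫ x : ℝ, g x * cexp (I * (((u₀ + j * s : ℝ) : ℂ) - I * δ) * (x : ℂ))) *
            conj ((∫ x : ℝ, g x * cexp (I * (((u₀ + j * s : ℝ) : ℂ) + I * δ) * (x : ℂ))))).re
      else ‖(∫ x : ℝ, g x * cexp (I * (((u₀ + j * s : ℝ) : ℂ)) * (x : ℂ)))‖ ^ 2) := by
  apply soloBlind_universal_sharp_nonneg s δ a u₀ hs ha hδ haT _ P hg hsupp
  have hs0 : 0 ≤ Real.sinh (δ * a) := Real.sinh_nonneg_iff.mpr (by positivity)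
  have hs1 : Real.sinh (δ * a) ≤ Real.sqrt 2 / 2 := by
    have := Real.sinh_le_sinh.mpr hδa
    rwa [Real.sinh_arsinh] at this
  have hsq : (Real.sqrt 2 / 2) ^ 2 = 1 / 2 := by
    rw [div_pow, Real.sq_sqrt (by norm_num : (0:ℝ) ≤ 2)]; norm_num
  nlinarith [mul_le_mul hs1 hs1 hs0 (by positivity), hsq]

end Summit.RiemannHypothesis.RiemannHypothesis.Theorems
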